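import Summits.BirchSwinnertonDyer.BirchSwinnertonDyer.Theses.TameQuarticManinParity
import Literature.NumberTheory.EllipticCurves.NewformCuspFourierValuationWeightK
import HarnessLib

/-!
# Route `TameQuarticManinParity`, support item `CuspValuationByDenominatorTypeOfCNS` (stmt-BirchSwinnertonDyer-31985) — PROVED BY NAME:
# the PRINT RECORD of U49 `CuspValuationByDenominatorType` (stmt-BirchSwinnertonDyer-23788) from the named fact [ČNS Lemma 5.13]

U49 as filed is the unconditional `p = 3`, `k = 2`, cusp-form instance of the tree's NAMED (unproved, cite-only) fact
`cesnaviciusNeururerSaha_lemma_5_13` (`NewformCuspFourierValuationWeightK`): cusps `γ∞`, `γ'∞` of `Γ₀(N)` whose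
denominators have the same `3`-adic valuation carry the same bounds on `‖ι⁻¹ a_g(n; ·)‖`.  The refuter's audit of U49
(bsd-print-cf2-ref g19, 2026-08-29) offered option (i) «restate as `cesnaviciusNeururerSaha_lemma_5_13 → <U49 body>`»; the
route planner (bsd-idea-3 g17) filed that implication ADDITIVELY as the support item `CuspValuationByDenominatorTypeOfCNS`
(stmt-BirchSwinnertonDyer-31985; the same pattern as TTD's `TwistedPeriodLatticeSaturationOfNamedInputs`, director (504)),
leaving U49 open as pure-cite tier and the LINE-49 glue (stmt-BirchSwinnertonDyer-23793) with its landed proof untouched.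
This file proves the item BY NAME (`cuspValuationByDenominatorTypeOfCNS`, one specialisation step via Mathlib's
`CuspForm.toModularFormₗ`).  It does NOT prove U49 as filed (that would prove an instance
of an open literature lemma), proves no crux, and BSD is NOT proved.  THEOREMS ONLY; axioms std.
-/

set_option autoImplicit false
-- D-0017: single-problem summit, so `Summit.BirchSwinnertonDyer.BirchSwinnertonDyer.…` repeats a namespace BY DESIGN.
set_option linter.dupNamespace false

noncomputable section

namespace Summit.BirchSwinnertonDyer.BirchSwinnertonDyer.Theorems.TameQuarticManinParity

open scoped MatrixGroups
open CongruenceSubgroup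
open Summit.BirchSwinnertonDyer.BirchSwinnertonDyer.Theses.TameQuarticManinParity
open Literature.NumberTheory.EllipticCurves.ModularForms

/-- **`CuspValuationByDenominatorTypeOfCNS` BY NAME** (route `TameQuarticManinParity`, support item
stmt-BirchSwinnertonDyer-31985, the PRINT RECORD of U49): the named fact `cesnaviciusNeururerSaha_lemma_5_13` (all levels,
primes, weights `k ≥ 1`, modular forms) specialises to the route item U49 `CuspValuationByDenominatorType` (`p = 3`, `k = 2`,
cusp forms, via Mathlib's inclusion `CuspForm.toModularFormₗ`).  U49 itself (stmt-BirchSwinnertonDyer-23788) is NOT closed by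
this (pure-cite tier); BSD is not proved by this. [cite: CesnaviciusNeururerSaha2023, Lemma 5.13 (pp. 38–39)] -/
theorem cuspValuationByDenominatorTypeOfCNS : CuspValuationByDenominatorTypeOfCNS := by
  intro h N _ g ι γ γ' hγ B hB n
  haveI : Fact (Nat.Prime 3) := ⟨Nat.prime_three⟩
  have hcoe : ⇑(CuspForm.toModularFormₗ g : ModularForm (Gamma0 N) 2) = ⇑g := rfl
  have := h N 3 2 (by norm_num) (CuspForm.toModularFormₗ g) ι γ γ' hγ B (by rw [hcoe]; exact hB) n
  rwa [hcoe] at this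

end Summit.BirchSwinnertonDyer.BirchSwinnertonDyer.Theorems.TameQuarticManinParity

end
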